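import Mathlib.Tactic

/-!
# LEMMA R — finite model (bsd-idea-19 g24, 2026-08-29)

Work-file model (NOT a Theorems file; imported by nothing) of LEMMA R of
`Lines/two-parity-modular-unit-note.md` §5 (the inclusion `R_μ ⊆ ker Φ_a`):

  for `D ∣ M′`, `D < M′`, `e = M′/D`, `w ∈ (ℤ/D)²`, every `γ ∈ SL₂(ℤ/M′)` and every `K ≥ 1`,
  `coef_K(γ)[1_{v ≡ w (D)}] = e^{2a} · coef_K(γ)[δ_{e ŵ}]`,

where `coef_K(γ)[μ] = Σ_{kc = K, p ∤ k} k^{1-2a} Σ_{t mod M′} μ((k,t)γ⁻¹) ζ_{M′}^{tc}`.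
We check it over `𝔽_p` with `M′ ∣ p - 1` (so `ζ_{M′} ∈ 𝔽_p`; exponent `1-2a` read mod `p-1`),
for ALL `γ`, ALL `(D, w)`, ALL `K ≤ B`, by `native_decide`.  Sanity model only; nothing here
proves BSD / C5 / R / I9.
-/

set_option linter.dupNamespace false

namespace Summit.BirchSwinnertonDyer.BirchSwinnertonDyer.Cruxes.ManinPrimeToAdditiveFiveLe.TwoParity.LemmaR

/-- `SL₂(ℤ/M)` as quadruples `(A,B,C,D)` -/
def gammaList (M : ℕ) : List (ℕ × ℕ × ℕ × ℕ) :=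
  ((List.range M).flatMap fun A => (List.range M).flatMap fun B =>
    (List.range M).flatMap fun C => (List.range M).map fun D => (A, B, C, D)).filter
    fun g => (g.1 * g.2.2.2 + (M * M - g.2.1 * g.2.2.1)) % M == 1 % M

/-- an element of exact order `M` in `𝔽_p` (0 if none) -/
def zetaOf (p M : ℕ) : ℕ :=
  ((List.range p).find? fun z => 0 < z && (z ^ M) % p == 1 &&
    ((List.range M).filter fun j => 0 < j && (z ^ j) % p == 1).isEmpty).getD 0

/-- `coef_K(γ)[μ]` over `𝔽_p` for `μ` given as a Boolean-valued indicator `ind` on `(ℤ/M)²`: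
`Σ_{kc=K, p∤k} k^{(1-2a) mod (p-1)} Σ_t [ind((k,t)γ⁻¹)] ζ^{tc}`; `γ⁻¹ = (D,-B;-C,A)`. -/
def coefInd (p M a K : ℕ) (g : ℕ × ℕ × ℕ × ℕ) (ind : ℕ × ℕ → Bool) : ℕ :=
  let z := zetaOf p M
  let A := g.1; let B := g.2.1; let C := g.2.2.1; let D := g.2.2.2
  let s := (p - 1 + 1 - (2 * a) % (p - 1)) % (p - 1)
  ((List.range (K + 1)).map fun k =>
    if k == 0 || K % k != 0 || k % p == 0 then 0 else
      let c := K / k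
      let inner := ((List.range M).map fun t =>
        let v0 := (k * D + (M * M * M - (t * C) % (M * M * M))) % M
        let v1 := (t * A + (M * M * M - (k * B) % (M * M * M))) % M
        if ind (v0, v1) then (z ^ ((t * c) % M)) % p else 0).sum
      ((k ^ s) % p) * inner).sum % p

/-- the LEMMA R identity for one `(D, w, γ, K)`; `wl` is a lift of `w` to `(ℤ/M)²`, `e = M/D` -/
def lemmaROne (p M a Dm K : ℕ) (wl : ℕ × ℕ) (g : ℕ × ℕ × ℕ × ℕ) : Bool :=
  let e := M / Dm
  let lhs := coefInd p M a K g fun v => v.1 % Dm == wl.1 % Dm && v.2 % Dm == wl.2 % Dm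
  let rhs := coefInd p M a K g fun v => v.1 == (e * wl.1) % M && v.2 == (e * wl.2) % M
  lhs % p == ((e ^ (2 * a)) % p * rhs) % p

/-- LEMMA R for all proper divisors `D` of `M`, all `w ∈ (ℤ/D)²` (canonical lift), all `γ ∈ SL₂(ℤ/M)`,
all `1 ≤ K ≤ B` (and `ζ` of exact order `M` exists in `𝔽_p`). -/
def lemmaRCheck (p M a B : ℕ) : Bool :=
  0 < zetaOf p M &&
  (((List.range M).filter fun Dm => 0 < Dm && M % Dm == 0).all fun Dm =>
    (List.range Dm).all fun w0 => (List.range Dm).all fun w1 =>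
      (gammaList M).all fun g => ((List.range (B + 1)).filter (0 < ·)).all fun K =>
        lemmaROne p M a Dm K (w0, w1) g)

/-- the same with ALL lifts `ŵ ∈ (ℤ/M)²` of `w` (lift-independence of `δ_{eŵ}`) -/
def lemmaRCheckLifts (p M a B : ℕ) : Bool :=
  0 < zetaOf p M &&
  (((List.range M).filter fun Dm => 0 < Dm && M % Dm == 0).all fun Dm =>
    (List.range M).all fun w0 => (List.range M).all fun w1 =>
      (gammaList M).all fun g => ((List.range (B + 1)).filter (0 < ·)).all fun K =>
        lemmaROne p M a Dm K (w0, w1) g)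

/-- negative control: with the wrong weight `e^{2a+1}` the identity fails somewhere -/
def lemmaRWrong (p M a B : ℕ) : Bool :=
  (((List.range M).filter fun Dm => 0 < Dm && M % Dm == 0).all fun Dm =>
    (List.range Dm).all fun w0 => (List.range Dm).all fun w1 =>
      (gammaList M).all fun g => ((List.range (B + 1)).filter (0 < ·)).all fun K =>
        let e := M / Dm
        let lhs := coefInd p M a K g fun v => v.1 % Dm == w0 % Dm && v.2 % Dm == w1 % Dm
        let rhs := coefInd p M a K g fun v => v.1 == (e * w0) % M && v.2 == (e * w1) % M
        lhs % p == ((e ^ (2 * a + 1)) % p * rhs) % p)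

/-- (p, M′) = (5, 4): all γ (48), all (D,w), K ≤ 12, a = 1, 2. -/
theorem lemmaR_5_4_a1 : lemmaRCheck 5 4 1 12 = true := by native_decide
theorem lemmaR_5_4_a2 : lemmaRCheck 5 4 2 12 = true := by native_decide
/-- (7, 3): all γ (24), K ≤ 12, a = 1, 2, 3. -/
theorem lemmaR_7_3_a1 : lemmaRCheck 7 3 1 12 = true := by native_decide
theorem lemmaR_7_3_a2 : lemmaRCheck 7 3 2 12 = true := by native_decide
theorem lemmaR_7_3_a3 : lemmaRCheck 7 3 3 12 = true := by native_decide
/-- (7, 6): all γ (144), K ≤ 12, a = 1, 2, 3. -/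
theorem lemmaR_7_6_a1 : lemmaRCheck 7 6 1 12 = true := by native_decide
theorem lemmaR_7_6_a2 : lemmaRCheck 7 6 2 12 = true := by native_decide
theorem lemmaR_7_6_a3 : lemmaRCheck 7 6 3 12 = true := by native_decide
theorem lemmaR_7_6_a1_lifts : lemmaRCheckLifts 7 6 1 6 = true := by native_decide
/-- (13, 12): all γ (1152), all (D,w) with D | 12, D < 12, K ≤ 12, a = 1. -/
theorem lemmaR_13_12_a1 : lemmaRCheck 13 12 1 12 = true := by native_decide
/-- negative control at (7, 6), a = 1: the weight e^{2a+1} is wrong. -/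
theorem lemmaR_7_6_wrong : lemmaRWrong 7 6 1 12 = false := by native_decide

end Summit.BirchSwinnertonDyer.BirchSwinnertonDyer.Cruxes.ManinPrimeToAdditiveFiveLe.TwoParity.LemmaR
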